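import Literature.MathematicalPhysics.QuantumLattice.HubbardChainEnergyDensityConvex
import Literature.MathematicalPhysics.QuantumLattice.HubbardChainDopedSegmentUpperBound
import Literature.MathematicalPhysics.QuantumLattice.HubbardChainTorusLimitState
import Literature.MathematicalPhysics.QuantumLattice.InfVolFermionStateHubbardMeanEnergyBox
import Literature.MathematicalPhysics.QuantumLattice.HubbardStateSectorDecomposition
import Literature.MathematicalPhysics.QuantumLattice.HubbardFermionInteractionLocalHamiltonian
import Literature.MathematicalPhysics.QuantumLattice.HubbardRectangularTorus
import HarnessLib

/-!
# The variational principle for the ground-state energy density of the Hubbard chain: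
# `hubbardChainEnergyDensityAt` is the least energy density of a translation-invariant state

Topic `Literature/MathematicalPhysics/QuantumLattice`; namespace
`Literature.MathematicalPhysics.QuantumLattice`. The `d = 1` companion of
`HubbardEnergyDensityVariationalPrinciple.lean` (square lattice). The thermodynamic limit
`e(p/q) = hubbardChainEnergyDensityAt t U p q = lim_m E_{qm}(pm)/(qm)` of the ground-state energy per
site of the Hubbard ring at the rational filling `p/q` (`HubbardChainEnergyDensityAt.lean`) is a LOWER
BOUND for the Hubbard energy density `e(ω) = Re ω(E_Φ)` (`InfVolFermionState.hubbardEnergyDensity`) of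
EVERY translation-invariant infinite-volume state `ω` of the lattice fermion system on `ℤ` with particle
density `ρ(ω) = p/q ∈ (0, 2)` (`U ≥ 0`):

`InfVolFermionState.IsTranslationInvariant.hubbardChainEnergyDensityAt_le_hubbardEnergyDensity :
  hubbardChainEnergyDensityAt t U p q ≤ ω.hubbardEnergyDensity t U`.

Together with the attained half `exists_isTranslationInvariant_hubbardEnergyDensity_eq_chainAt`
(`HubbardChainTorusLimitState.lean`: torus limits of sector ground states of the rings realise
`e(p/q)`), this is the infinite-volume variational principle
`isLeast_hubbardEnergyDensity_hubbardChainEnergyDensityAt` — the Bratteli–Kishimoto–Robinson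
characterisation of translation-invariant ground states as minimisers of the mean energy, here at
fixed density for the Hubbard chain, with Ruelle's elementary proof (*Statistical Mechanics* (1969)
§2.4, §3.3–3.4): restrict `ω` to the segments `[0,ℓ) ⊆ ℤ`; the free-boundary segment Hamiltonian has
expectation within `4|t|` of `ℓ·e(ω)` (one missing bond; `InfVolFermionStateHubbardMeanEnergyBox`), is at
least the number-distribution average of the sector ground energies of the open segment
(`HubbardStateSectorDecomposition`), the segment IS the open path graph
(`groundEnergyAt_polyGraph_halfOpenBox_one`, a graph isomorphism), every sector ground energy of the
open segment satisfies `ℓ·e(N/ℓ) ≤ E_{path ℓ}(N)` EXACTLY (`hubbardChainEnergyDensityAt_le_segment`),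
and `e(N/ℓ) ≥ e(p/q) + s·(N/ℓ - p/q)` for a supporting slope `s` of the convex `e` at `p/q`
(`exists_supporting_line_hubbardChainEnergyDensityAt`); the affine terms collapse by `Σ p_N = 1`,
`Σ N p_N = ℓ·p/q`, leaving `ℓ·e(p/q) ≤ ℓ·e(ω) + 4|t|`, and `ℓ → ∞`. Half filling (`p = q = 1`,
`hubbardChainEnergyDensity t U`) is spelled out. Everything is PROVED; no definition, no named fact.

## References

* D. Ruelle, *Statistical Mechanics: Rigorous Results* (1969), §2.4, §3.3–§3.4. [cite: Ruelle1969, §3.4]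
* O. Bratteli, A. Kishimoto, D. W. Robinson, Commun. Math. Phys. 64 (1978) 41–48, §3 Thm. 2.
  [cite: BratteliKishimotoRobinson1978, §3 Thm. 2]
* O. Bratteli, D. W. Robinson, *Operator Algebras and Quantum Statistical Mechanics II* (1997),
  §6.2.4. [cite: BratteliRobinsonII1997, §6.2.4]
-/

noncomputable section

namespace Literature.MathematicalPhysics.QuantumLattice

open Matrix Finset HubbardWave0 _root_.Filter Literature.Probability.LatticeModels ThermodynamicLimit
open scoped _root_.Topology ComplexOrder

/-! ### The segment `[0,ℓ) ⊆ ℤ` is the open path graph on `ℓ` sites -/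

namespace ThermodynamicLimit

/-- Coordinates of the sites of `[0,ℓ) ⊆ ℤ` lie in `[0, ℓ)`. [folklore] -/
private theorem coord_mem_of_polySite_halfOpenBox_one {ℓ : ℕ} (a : PolySite (halfOpenBox 1 ℓ)) :
    0 ≤ ofLex a.1 0 ∧ ofLex a.1 0 < ℓ :=
  (mem_halfOpenBox.1 (PolySite.ofLex_mem a)) 0

/-- **The sites of the segment `[0,ℓ) ⊆ ℤ` are `Fin ℓ`**, by the coordinate, and the induced
nearest-neighbour graph is Mathlib's path graph: there is a site bijection `f` with
`(pathGraph ℓ).Adj (f a) (f b) ↔ (polyGraph [0,ℓ)).Adj a b`. [folklore] -/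
private theorem exists_equiv_polySite_halfOpenBox_one (ℓ : ℕ) :
    ∃ f : PolySite (halfOpenBox 1 ℓ) ≃ Fin ℓ, (∀ a, (((f a : ℕ)) : ℤ) = ofLex a.1 0) ∧
      ∀ a b, (SimpleGraph.pathGraph ℓ).Adj (f a) (f b) ↔ (polyGraph (halfOpenBox 1 ℓ)).Adj a b := by
  have hlt : ∀ a : PolySite (halfOpenBox 1 ℓ), (ofLex a.1 0).toNat < ℓ := fun a => by
    have h := coord_mem_of_polySite_halfOpenBox_one a
    omega
  set g : PolySite (halfOpenBox 1 ℓ) → Fin ℓ := fun a => ⟨(ofLex a.1 0).toNat, hlt a⟩ with hg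
  have hg0 : ∀ a, (((g a : ℕ)) : ℤ) = ofLex a.1 0 := fun a => by
    have h := (coord_mem_of_polySite_halfOpenBox_one a).1
    simp only [hg]
    omega
  have hext : ∀ a b : PolySite (halfOpenBox 1 ℓ), ofLex a.1 0 = ofLex b.1 0 → a = b := by
    intro a b h
    have : ofLex a.1 = ofLex b.1 := by
      funext i
      rw [Subsingleton.elim i 0]
      exact h
    exact Subtype.ext (ofLex.injective this)
  have hinj : Function.Injective g := fun a b h => hext a b (by rw [← hg0 a, ← hg0 b, h])
  have hsurj : Function.Surjective g := by
    intro p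
    set x : Site 1 := fun _ => ((p : ℕ) : ℤ) with hx
    have hxmem : x ∈ halfOpenBox 1 ℓ := by
      rw [mem_halfOpenBox]
      intro i
      show 0 ≤ ((p : ℕ) : ℤ) ∧ ((p : ℕ) : ℤ) < ℓ
      exact ⟨Nat.cast_nonneg _, by exact_mod_cast p.isLt⟩
    refine ⟨PolySite.pt x hxmem, Fin.ext ?_⟩
    have h := hg0 (PolySite.pt x hxmem)
    rw [PolySite.ofLex_coe_pt] at h
    have h' : (((g (PolySite.pt x hxmem) : ℕ)) : ℤ) = ((p : ℕ) : ℤ) := h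
    exact_mod_cast h'
  refine ⟨Equiv.ofBijective g ⟨hinj, hsurj⟩, hg0, fun a b => ?_⟩
  rw [SimpleGraph.pathGraph_adj, polyGraph_adj, zdGraph_adj_iff]
  simp only [Equiv.ofBijective_apply]
  have ha := hg0 a
  have hb := hg0 b
  constructor
  · rintro (h | h)
    · refine ⟨0, Or.inl (funext fun i => ?_)⟩
      rw [Subsingleton.elim i 0, Pi.add_apply, Pi.single_eq_same]
      have : ((g a : ℕ) : ℤ) + 1 = ((g b : ℕ) : ℤ) := by exact_mod_cast h
      omega
    · refine ⟨0, Or.inr (funext fun i => ?_)⟩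
      rw [Subsingleton.elim i 0, Pi.add_apply, Pi.single_eq_same]
      have : ((g b : ℕ) : ℤ) + 1 = ((g a : ℕ) : ℤ) := by exact_mod_cast h
      omega
  · rintro ⟨i, h | h⟩
    · left
      have hc := congrFun h 0
      rw [Subsingleton.elim i 0, Pi.add_apply, Pi.single_eq_same] at hc
      have : ((g a : ℕ) : ℤ) + 1 = ((g b : ℕ) : ℤ) := by omega
      exact_mod_cast this
    · right
      have hc := congrFun h 0
      rw [Subsingleton.elim i 0, Pi.add_apply, Pi.single_eq_same] at hc
      have : ((g b : ℕ) : ℤ) + 1 = ((g a : ℕ) : ℤ) := by omega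
      exact_mod_cast this

/-- The segment `[0,ℓ) ⊆ ℤ` has `ℓ` sites. [folklore] -/
private theorem card_polySite_halfOpenBox_one (ℓ : ℕ) : Fintype.card (PolySite (halfOpenBox 1 ℓ)) = ℓ := by
  obtain ⟨f, -, -⟩ := exists_equiv_polySite_halfOpenBox_one ℓ
  rw [Fintype.card_congr f, Fintype.card_fin]

/-- **The free-boundary Hubbard Hamiltonian of the segment `[0,ℓ) ⊆ ℤ` has the sector ground energies
of the open chain on `ℓ` sites**: `E_{polyGraph [0,ℓ)}(N) = E_{pathGraph ℓ}(N)` (graph isomorphism,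
`groundEnergyAt_eq_of_iso`). Ruelle (1969) §2.2 (boxes). [cite: Ruelle1969, §2.2] -/
theorem groundEnergyAt_polyGraph_halfOpenBox_one (ℓ : ℕ) (t U : ℝ) (N : ℕ) :
    groundEnergyAt (polyGraph (halfOpenBox 1 ℓ)) t U N = groundEnergyAt (SimpleGraph.pathGraph ℓ) t U N := by
  obtain ⟨f, -, hf⟩ := exists_equiv_polySite_halfOpenBox_one ℓ
  exact (groundEnergyAt_eq_of_iso (polyGraph (halfOpenBox 1 ℓ)) (SimpleGraph.pathGraph ℓ) f hf t U N).symm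

/-- **The thermodynamic energy density minorises every sector of the open segment, exactly**:
`ℓ · e(N/ℓ) ≤ E_{[0,ℓ)}(N)` for `U ≥ 0`, `ℓ ≥ 1`, `N ≤ 2ℓ`, with `e(N/ℓ) = hubbardChainEnergyDensityAt t U N ℓ`
and the free-boundary segment Hamiltonian `hamiltonian (polyGraph (halfOpenBox 1 ℓ)) t U` (rings tiled by
copies of the segment: `hubbardChainEnergyDensityAt_le_segment`; no boundary term). [cite: Ruelle1969, §3.3] -/
theorem mul_hubbardChainEnergyDensityAt_le_groundEnergyAt_halfOpenBox_one (t : ℝ) {U : ℝ} (hU : 0 ≤ U)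
    {ℓ : ℕ} (hℓ : 1 ≤ ℓ) {N : ℕ} (hN : N ≤ 2 * ℓ) :
    (ℓ : ℝ) * hubbardChainEnergyDensityAt t U N ℓ ≤ groundEnergyAt (polyGraph (halfOpenBox 1 ℓ)) t U N := by
  have hℓpos : (0 : ℝ) < ℓ := by exact_mod_cast hℓ
  have h := hubbardChainEnergyDensityAt_le_segment t hU (p := N) (q := ℓ) (a := ℓ) (N₀ := N) hℓ hN hℓ rfl
  rw [groundEnergyAt_polyGraph_halfOpenBox_one, ← le_div_iff₀' hℓpos]
  exact h

/-- In the segment `[0,ℓ) ⊆ ℤ`, at most one site has its right neighbour outside the segment (the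
site `ℓ - 1`). [folklore] -/
private theorem card_filter_add_unitVec_not_mem_halfOpenBox_one_le (ℓ : ℕ) :
    ((halfOpenBox 1 ℓ).filter fun x => x + unitVec 0 ∉ halfOpenBox 1 ℓ).card ≤ 1 := by
  refine Finset.card_le_one.2 fun x hx y hy => ?_
  have hxm := mem_filter.1 hx
  have hym := mem_filter.1 hy
  rw [mem_halfOpenBox, mem_halfOpenBox, not_forall] at hxm hym
  obtain ⟨i, hi⟩ := hxm.2
  obtain ⟨j, hj⟩ := hym.2
  rw [Subsingleton.elim i 0] at hi
  rw [Subsingleton.elim j 0] at hj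
  have hx0 := hxm.1 0
  have hy0 := hym.1 0
  simp only [unitVec, Pi.add_apply, Pi.single_eq_same] at hi hj
  funext k
  rw [Subsingleton.elim k 0]
  omega

end ThermodynamicLimit

namespace InfVolFermionState

variable {d : ℕ}

/-! ### Translation-invariant states: one-site densities and the expected particle number (any `d`) -/

/-- For translation-invariant `ω` on `ℤ^d`, the one-site densities do not depend on the site:
`ω(n_{xσ}) = ω(n_{0σ})` (the `d`-dimensional form of `IsTranslationInvariant.expect_nAt`).
[cite: ArakiMoriya2003, §4.1 Def. 4.5] -/
theorem IsTranslationInvariant.expect_nAt_eq_expect_nAt_zero {ω : InfVolFermionState d}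
    (hω : ω.IsTranslationInvariant) (x : Site d) (σ : Fin 2) :
    ω.expect {x} (nAt x (mem_singleton_self x) σ) = ω.expect {0} (nAt 0 (mem_singleton_self 0) σ) := by
  conv_rhs => rw [← hω x, shift_expect]
  refine ω.expect_fermionEmbed_incl_eq (subset_refl {x}) (shiftSet_singleton_zero_subset x) _ _ ?_
  have hpt : ∀ (h : 0 + x ∈ ({x} : Finset (Site d))) (h' : x ∈ ({x} : Finset (Site d))),
      (PolySite.pt (0 + x) h : PolySite ({x} : Finset (Site d))) = PolySite.pt x h' := fun h h' =>
    Subtype.ext (congrArg toLex (zero_add x))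
  simp only [fermionEmbed_numberOp, PolySite.shiftEmb_pt, PolySite.incl_pt]
  rw [hpt _ (mem_singleton_self x)]

/-- **The expected particle number of a region is `|Λ| × density`** for translation-invariant `ω`
on `ℤ^d`: `Re ω(N_Λ) = |Λ| ρ(ω)` (the `d`-dimensional form of
`IsTranslationInvariant.re_expect_totalNumber`). [cite: BratteliRobinsonII1997, §6.2.4] -/
theorem IsTranslationInvariant.re_expect_totalNumber_eq_card_mul {ω : InfVolFermionState d}
    (hω : ω.IsTranslationInvariant) (Λ : Finset (Site d)) :
    (ω.expect Λ (totalNumber : FermionOp Λ)).re = Λ.card * ω.density := by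
  let e : PolySite Λ ≃ {x // x ∈ Λ} :=
    ⟨fun a => ⟨ofLex a.1, PolySite.ofLex_mem a⟩, fun x => PolySite.pt x.1 x.2, fun a => PolySite.pt_ofLex a,
      fun x => Subtype.ext rfl⟩
  have hsum : (totalNumber : FermionOp Λ) =
      ∑ x ∈ Λ.attach, (numberOp (PolySite.pt x.1 x.2) 0 + numberOp (PolySite.pt x.1 x.2) 1) := by
    rw [totalNumber, ← Finset.univ_eq_attach]
    refine Fintype.sum_equiv e _ _ fun a => ?_
    rw [Fin.sum_univ_two, show PolySite.pt (e a).1 (e a).2 = e.symm (e a) from rfl, Equiv.symm_apply_apply]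
  have hterm : ∀ x : {x // x ∈ Λ},
      (ω.expect Λ (numberOp (PolySite.pt x.1 x.2) 0 + numberOp (PolySite.pt x.1 x.2) 1)).re = ω.density := by
    intro x
    have hcomp : ∀ σ : Fin 2, ω.expect Λ (numberOp (PolySite.pt x.1 x.2) σ) =
        ω.expect {x.1} (nAt x.1 (mem_singleton_self x.1) σ) := by
      intro σ
      rw [← ω.compatible (singleton_subset_iff.2 x.2) (nAt x.1 (mem_singleton_self x.1) σ), nAt,
        fermionEmbed_numberOp, PolySite.incl_pt]
    rw [map_add, hcomp, hcomp, hω.expect_nAt_eq_expect_nAt_zero x.1 0, hω.expect_nAt_eq_expect_nAt_zero x.1 1,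
      ← map_add, density, densityAt]
  rw [hsum, map_sum, Complex.re_sum, Finset.sum_congr rfl fun x _ => hterm x, sum_const, card_attach, nsmul_eq_mul]

/-! ### One dimension: the mean energy versus the segment Hamiltonians -/

/-- **Mean energy versus segment Hamiltonian** (one dimension): for a translation-invariant state `ω`
on `ℤ` and the segments `Λ_ℓ = [0,ℓ)`, `Re ω(H_{Λ_ℓ}) ≤ ℓ·e(ω) + 4|t|`, where `e(ω)` is the Hubbard energy
density and `H_Λ = Σ_{X⊆Λ} Φ(X)` the free-boundary segment Hamiltonian (the ONE bond leaving the segment,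
of energy `≤ 4|t|` in modulus, is counted with weight `1` in `ℓ·e(ω)` and `0` in `H_Λ`). Bratteli–Robinson II
§6.2.4 (the mean energy of a periodic state is `lim ω(H_Λ)/|Λ|`).
[cite: BratteliRobinsonII1997, §6.2.4 (Prop. 6.2.38 ff.)] -/
theorem IsTranslationInvariant.re_expect_localHamiltonian_le_mul_hubbardEnergyDensity_add
    {ω : InfVolFermionState 1} (hω : ω.IsTranslationInvariant) (t U : ℝ) (ℓ : ℕ) :
    (ω.expect (halfOpenBox 1 ℓ) ((hubbardFermionInteraction 1 t U).localHamiltonian (halfOpenBox 1 ℓ))).re ≤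
      (ℓ : ℝ) * ω.hubbardEnergyDensity t U + 4 * |t| := by
  classical
  set u : ℂ := ω.expect {0} ((hubbardFermionInteraction 1 t U).Φ {0}) with hu
  set h : ℂ := ω.expect {0, 0 + unitVec 0} ((hubbardFermionInteraction 1 t U).Φ {0, 0 + unitVec 0}) with hh
  set c : ℕ := ((halfOpenBox 1 ℓ).filter fun x => x + unitVec 0 ∈ halfOpenBox 1 ℓ).card with hc
  have he : ω.hubbardEnergyDensity t U = u.re + h.re := by
    rw [InfVolFermionState.hubbardEnergyDensity, InfVolFermionState.meanEnergy, hω.expect_hubbard_meanEnergyObs t U,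
      Complex.add_re, Complex.re_sum, Fin.sum_univ_one]
  have hcard : (halfOpenBox 1 ℓ).card = ℓ := by rw [card_halfOpenBox, pow_one]
  have hH : (ω.expect (halfOpenBox 1 ℓ) ((hubbardFermionInteraction 1 t U).localHamiltonian (halfOpenBox 1 ℓ))).re =
      (ℓ : ℝ) * u.re + (c : ℝ) * h.re := by
    rw [hω.expect_hubbard_localHamiltonian t U (halfOpenBox 1 ℓ), hcard, Complex.add_re, Complex.re_sum,
      Fin.sum_univ_one]
    congr 1
    · rw [show ((ℓ : ℕ) : ℂ) = ((ℓ : ℝ) : ℂ) by norm_cast, Complex.re_ofReal_mul]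
    · rw [show ((c : ℕ) : ℂ) = ((c : ℝ) : ℂ) by norm_cast, Complex.re_ofReal_mul]
  -- `ℓ - 1 ≤ c ≤ ℓ`
  have hc_le : c ≤ ℓ := hcard ▸ card_filter_le _ _
  have hc_ge : ℓ ≤ c + 1 := by
    have hsplit := Finset.card_filter_add_card_filter_not (s := halfOpenBox 1 ℓ) (fun x => x + unitVec 0 ∈ halfOpenBox 1 ℓ)
    have hbd := card_filter_add_unitVec_not_mem_halfOpenBox_one_le ℓ
    rw [hcard] at hsplit
    simp only [hc]
    omega
  have hhb : |h.re| ≤ 4 * |t| := abs_re_expect_hubbard_pair_le t U ω 0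
  rw [hH, he, mul_add]
  have h1 : (c : ℝ) ≤ ℓ := by exact_mod_cast hc_le
  have h2 : (ℓ : ℝ) ≤ c + 1 := by exact_mod_cast hc_ge
  have habs := abs_le.1 hhb
  nlinarith [habs.1, habs.2, abs_nonneg t]

/-! ### The variational lower bound -/

/-- **No translation-invariant state of the chain has energy density below the thermodynamic
ground-state energy density at its filling.** For the Hubbard chain with `U ≥ 0` and hopping `t`: if
`ω` is a translation-invariant infinite-volume state of the lattice fermion system on `ℤ` with rational
particle density `ρ(ω) = p/q ∈ (0, 2)`, then `hubbardChainEnergyDensityAt t U p q ≤ e(ω)`, `e(ω)` its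
Hubbard energy density. (Restrict to the segments `[0,ℓ)`: `Re ω(H_{[0,ℓ)}) ≤ ℓ e(ω) + 4|t|`;
`Re ω(H) ≥ Σ_N p_N E(N)` with the number distribution `p_N` of `ω` in the segment; every
`E(N) ≥ ℓ (e(p/q) + s (N/ℓ - p/q))` for a supporting slope `s` of the convex `e` at `p/q`; summing with
`Σ p_N = 1`, `Σ N p_N = ℓ·p/q` leaves `ℓ e(p/q) ≤ ℓ e(ω) + 4|t|`, and `ℓ → ∞`.) Ruelle (1969) §2.4,
§3.3–3.4; Bratteli–Kishimoto–Robinson (1978) Thm. 2 / Araki–Moriya (2003) §7 for the general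
variational principle. [cite: Ruelle1969, §3.4] -/
theorem IsTranslationInvariant.hubbardChainEnergyDensityAt_le_hubbardEnergyDensity {ω : InfVolFermionState 1}
    (hω : ω.IsTranslationInvariant) (t : ℝ) {U : ℝ} (hU : 0 ≤ U) {p q : ℕ} (hq : 1 ≤ q) (hp0 : 0 < p)
    (hp : p < 2 * q) (hρ : ω.density = (p : ℝ) / q) :
    hubbardChainEnergyDensityAt t U p q ≤ ω.hubbardEnergyDensity t U := by
  obtain ⟨s, hs⟩ := exists_supporting_line_hubbardChainEnergyDensityAt t hU hq hp0 hp
  set e₀ := hubbardChainEnergyDensityAt t U p q with he₀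
  -- the estimate at segment length `ℓ ≥ 1`
  have hbox : ∀ ℓ : ℕ, 1 ≤ ℓ → (ℓ : ℝ) * e₀ ≤ (ℓ : ℝ) * ω.hubbardEnergyDensity t U + 4 * |t| := by
    intro ℓ hℓ
    have hℓpos : (0 : ℝ) < ℓ := by exact_mod_cast hℓ
    have hcardO : Fintype.card (Orb (PolySite (halfOpenBox 1 ℓ))) = 2 * ℓ := by
      rw [card_orb, card_polySite_halfOpenBox_one]
    -- (4) the mean energy versus the free-boundary segment Hamiltonian
    have h4 := hω.re_expect_localHamiltonian_le_mul_hubbardEnergyDensity_add t U ℓ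
    rw [hubbardFermionInteraction_localHamiltonian] at h4
    -- (1) the sector decomposition
    have h1 := ω.sum_re_expect_numberProj_mul_groundEnergyAt_le (halfOpenBox 1 ℓ) (polyGraph (halfOpenBox 1 ℓ)) t U
    -- (2) every sector of the segment lies above the supporting line
    have h2 : ∀ N ∈ range (Fintype.card (Orb (PolySite (halfOpenBox 1 ℓ))) + 1),
        (ℓ : ℝ) * e₀ + s * (N - (ℓ : ℝ) * ((p : ℝ) / q)) ≤ groundEnergyAt (polyGraph (halfOpenBox 1 ℓ)) t U N := by
      intro N hN
      rw [mem_range, hcardO, Nat.lt_succ_iff] at hN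
      have hsN := hs N ℓ hℓ hN
      have hseg := mul_hubbardChainEnergyDensityAt_le_groundEnergyAt_halfOpenBox_one t hU hℓ hN
      have hmul := mul_le_mul_of_nonneg_left hsN hℓpos.le
      have hNl : (ℓ : ℝ) * ((N : ℝ) / ℓ) = N := mul_div_cancel₀ _ hℓpos.ne'
      have hid : (ℓ : ℝ) * (e₀ + s * ((N : ℝ) / ℓ - (p : ℝ) / q)) = (ℓ : ℝ) * e₀ + s * (N - (ℓ : ℝ) * ((p : ℝ) / q)) := by
        have hre : (ℓ : ℝ) * (e₀ + s * ((N : ℝ) / ℓ - (p : ℝ) / q)) =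
            (ℓ : ℝ) * e₀ + s * ((ℓ : ℝ) * ((N : ℝ) / ℓ) - (ℓ : ℝ) * ((p : ℝ) / q)) := by ring
        rw [hre, hNl]
      linarith
    -- (3) the average over the number distribution `p_N = Re ω(P_N)`
    have hp1 := ω.sum_re_expect_numberProj (halfOpenBox 1 ℓ)
    have hpN : ∑ N ∈ range (Fintype.card (Orb (PolySite (halfOpenBox 1 ℓ))) + 1),
        (N : ℝ) * (ω.expect (halfOpenBox 1 ℓ) (numberProj N)).re = (ℓ : ℝ) * ((p : ℝ) / q) := by
      rw [ω.sum_mul_re_expect_numberProj, hω.re_expect_totalNumber_eq_card_mul, card_halfOpenBox, pow_one, hρ]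
    have h3 : (ℓ : ℝ) * e₀ ≤
        ∑ N ∈ range (Fintype.card (Orb (PolySite (halfOpenBox 1 ℓ))) + 1),
          (ω.expect (halfOpenBox 1 ℓ) (numberProj N)).re * groundEnergyAt (polyGraph (halfOpenBox 1 ℓ)) t U N := by
      calc (ℓ : ℝ) * e₀
          = ∑ N ∈ range (Fintype.card (Orb (PolySite (halfOpenBox 1 ℓ))) + 1),
              (ω.expect (halfOpenBox 1 ℓ) (numberProj N)).re * ((ℓ : ℝ) * e₀ + s * (N - (ℓ : ℝ) * ((p : ℝ) / q))) := by
            have hexp : ∀ N : ℕ, (ω.expect (halfOpenBox 1 ℓ) (numberProj N)).re *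
                ((ℓ : ℝ) * e₀ + s * (N - (ℓ : ℝ) * ((p : ℝ) / q))) =
                ((ℓ : ℝ) * e₀ - s * ((ℓ : ℝ) * ((p : ℝ) / q))) * (ω.expect (halfOpenBox 1 ℓ) (numberProj N)).re +
                  s * ((N : ℝ) * (ω.expect (halfOpenBox 1 ℓ) (numberProj N)).re) := fun N => by ring
            simp_rw [hexp]
            rw [Finset.sum_add_distrib, ← Finset.mul_sum, ← Finset.mul_sum, hp1, hpN]
            ring
        _ ≤ _ := Finset.sum_le_sum fun N hN =>
            mul_le_mul_of_nonneg_left (h2 N hN) (ω.re_expect_numberProj_nonneg _ N)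
    linarith
  -- `ℓ → ∞`
  refine le_of_forall_pos_lt_add fun ε hε => ?_
  obtain ⟨ℓ, hℓ⟩ := exists_nat_gt (4 * |t| / ε)
  have h := hbox (ℓ + 1) (Nat.le_add_left 1 ℓ)
  push_cast at h
  have hL : 4 * |t| / ε < (ℓ : ℝ) + 1 := hℓ.trans (lt_add_one _)
  rw [div_lt_iff₀ hε] at hL
  have hLpos : (0 : ℝ) < (ℓ : ℝ) + 1 := by positivity
  by_contra hcon
  push Not at hcon
  nlinarith [mul_le_mul_of_nonneg_left hcon hLpos.le]

/-- **Half filling**: for a translation-invariant state `ω` on `ℤ` of density `1` and `U ≥ 0`,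
`hubbardChainEnergyDensity t U ≤ e(ω)` (`p = q = 1`, `hubbardChainEnergyDensityAt_one_one`).
[cite: Ruelle1969, §3.4] -/
theorem IsTranslationInvariant.hubbardChainEnergyDensity_le_hubbardEnergyDensity {ω : InfVolFermionState 1}
    (hω : ω.IsTranslationInvariant) (t : ℝ) {U : ℝ} (hU : 0 ≤ U) (hρ : ω.density = 1) :
    hubbardChainEnergyDensity t U ≤ ω.hubbardEnergyDensity t U := by
  rw [← hubbardChainEnergyDensityAt_one_one t hU]
  exact hω.hubbardChainEnergyDensityAt_le_hubbardEnergyDensity t hU (p := 1) (q := 1) le_rfl one_pos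
    (by norm_num) (by rw [hρ]; norm_num)

/-! ### The variational principle -/

/-- **The variational principle for the ground-state energy density of the Hubbard chain.** For
`U ≥ 0` and a rational density `0 < p/q < 2`, Ruelle's thermodynamic limit
`hubbardChainEnergyDensityAt t U p q` of the ground-state energy per site of the rings is the LEAST
Hubbard energy density of a translation-invariant infinite-volume state on `ℤ` of particle density
`p/q` (lower bound: `IsTranslationInvariant.hubbardChainEnergyDensityAt_le_hubbardEnergyDensity`;
attained, by an even torus-limit state: `exists_isTranslationInvariant_hubbardEnergyDensity_eq_chainAt`).
Bratteli–Kishimoto–Robinson (1978) Thm. 2 / Bratteli–Robinson II Thm. 6.2.58 (ground states of lattice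
systems minimise the mean energy); Ruelle (1969) §3.4. [cite: BratteliKishimotoRobinson1978, §3 Thm. 2] -/
theorem isLeast_hubbardEnergyDensity_hubbardChainEnergyDensityAt (t : ℝ) {U : ℝ} (hU : 0 ≤ U) {p q : ℕ}
    (hq : 1 ≤ q) (hp0 : 0 < p) (hp : p < 2 * q) :
    IsLeast {e : ℝ | ∃ ω : InfVolFermionState 1, ω.IsTranslationInvariant ∧ ω.density = (p : ℝ) / q ∧
      ω.hubbardEnergyDensity t U = e} (hubbardChainEnergyDensityAt t U p q) := by
  refine ⟨hubbardChainEnergyDensityAt_mem_energies_of_isTranslationInvariant t hU hq hp.le, fun e he => ?_⟩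
  obtain ⟨ω, hti, hdens, he⟩ := he
  rw [← he]
  exact hti.hubbardChainEnergyDensityAt_le_hubbardEnergyDensity t hU hq hp0 hp hdens

/-- The same over translation-invariant EVEN states (the minimiser produced by
`exists_isTranslationInvariant_hubbardEnergyDensity_eq_chainAt` is even). [cite: BratteliKishimotoRobinson1978, §3 Thm. 2] -/
theorem isLeast_hubbardEnergyDensity_hubbardChainEnergyDensityAt_even (t : ℝ) {U : ℝ} (hU : 0 ≤ U)
    {p q : ℕ} (hq : 1 ≤ q) (hp0 : 0 < p) (hp : p < 2 * q) :
    IsLeast {e : ℝ | ∃ ω : InfVolFermionState 1, ω.IsTranslationInvariant ∧ ω.IsEven ∧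
      ω.density = (p : ℝ) / q ∧ ω.hubbardEnergyDensity t U = e} (hubbardChainEnergyDensityAt t U p q) := by
  refine ⟨?_, fun e he => ?_⟩
  · obtain ⟨ω, hti, hev, hdens, he⟩ := exists_isTranslationInvariant_hubbardEnergyDensity_eq_chainAt t hU hq hp.le
    exact ⟨ω, hti, hev, hdens, he⟩
  · obtain ⟨ω, hti, -, hdens, he⟩ := he
    rw [← he]
    exact hti.hubbardChainEnergyDensityAt_le_hubbardEnergyDensity t hU hq hp0 hp hdens

/-- **Half filling**: `hubbardChainEnergyDensity t U` is the least Hubbard energy density of a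
translation-invariant state on `ℤ` of density `1` (`U ≥ 0`). [cite: BratteliKishimotoRobinson1978, §3 Thm. 2] -/
theorem isLeast_hubbardEnergyDensity_hubbardChainEnergyDensity (t : ℝ) {U : ℝ} (hU : 0 ≤ U) :
    IsLeast {e : ℝ | ∃ ω : InfVolFermionState 1, ω.IsTranslationInvariant ∧ ω.density = 1 ∧
      ω.hubbardEnergyDensity t U = e} (hubbardChainEnergyDensity t U) := by
  have h := isLeast_hubbardEnergyDensity_hubbardChainEnergyDensityAt t hU (p := 1) (q := 1) le_rfl one_pos
    (by norm_num)
  rw [hubbardChainEnergyDensityAt_one_one t hU] at h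
  have hset : {e : ℝ | ∃ ω : InfVolFermionState 1, ω.IsTranslationInvariant ∧ ω.density = ((1 : ℕ) : ℝ) / (1 : ℕ) ∧
      ω.hubbardEnergyDensity t U = e} = {e : ℝ | ∃ ω : InfVolFermionState 1, ω.IsTranslationInvariant ∧
      ω.density = 1 ∧ ω.hubbardEnergyDensity t U = e} := by
    simp only [Nat.cast_one, div_one]
  rwa [hset] at h

/-- **Corollary (the variational class of upper bounds).** Every translation-invariant state on `ℤ`
of rational density `p/q ∈ (0,2)` — in particular the state generated by an injective translation-
invariant matrix-product state, or any explicitly constructed periodic trial state averaged over its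
period — certifies the UPPER bound `hubbardChainEnergyDensityAt t U p q ≤ E` as soon as its Hubbard
energy density is `≤ E` (`U ≥ 0`). [cite: Ruelle1969, §3.4] -/
theorem hubbardChainEnergyDensityAt_le_of_isTranslationInvariant (t : ℝ) {U : ℝ} (hU : 0 ≤ U) {p q : ℕ}
    (hq : 1 ≤ q) (hp0 : 0 < p) (hp : p < 2 * q) {ω : InfVolFermionState 1} (hω : ω.IsTranslationInvariant)
    (hρ : ω.density = (p : ℝ) / q) {E : ℝ} (hE : ω.hubbardEnergyDensity t U ≤ E) :
    hubbardChainEnergyDensityAt t U p q ≤ E :=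
  (hω.hubbardChainEnergyDensityAt_le_hubbardEnergyDensity t hU hq hp0 hp hρ).trans hE

/-- **Corollary (lower bounds valid on all translation-invariant states are sharp in the class).**
`E ≤ hubbardChainEnergyDensityAt t U p q` iff `E ≤ e(ω)` for every translation-invariant state `ω` on `ℤ`
of density `p/q` (`U ≥ 0`, `0 < p/q < 2`). [cite: Ruelle1969, §3.4] -/
theorem le_hubbardChainEnergyDensityAt_iff_forall_isTranslationInvariant (t : ℝ) {U : ℝ} (hU : 0 ≤ U)
    {p q : ℕ} (hq : 1 ≤ q) (hp0 : 0 < p) (hp : p < 2 * q) {E : ℝ} :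
    E ≤ hubbardChainEnergyDensityAt t U p q ↔
      ∀ ω : InfVolFermionState 1, ω.IsTranslationInvariant → ω.density = (p : ℝ) / q →
        E ≤ ω.hubbardEnergyDensity t U := by
  constructor
  · intro h ω hω hρ
    exact h.trans (hω.hubbardChainEnergyDensityAt_le_hubbardEnergyDensity t hU hq hp0 hp hρ)
  · intro h
    obtain ⟨ω, hti, -, hdens, he⟩ := exists_isTranslationInvariant_hubbardEnergyDensity_eq_chainAt t hU hq hp.le
    rw [← he]
    exact h ω hti hdens

end InfVolFermionState

end Literature.MathematicalPhysics.QuantumLattice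

end
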